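import Summits.Parity.GeneralizedHardyLittlewood.Theorems.DicksonFibrationDimOneEquivalence
import Literature.NumberTheory.Sieve.LinearEquationsInPrimesLocalObstruction
import Literature.NumberTheory.Sieve.LinearEquationsInPrimesCrudeBounds
import HarnessLib

/-!
# Route `DicksonFibration`, crux `DimOne` (stmt-Parity-0819), line `birth` (sieve model), part 3:
# the PROVABLE PERIMETER of the open stub — `t ≤ 1` and locally obstructed systems

Lead `prover-line-stmt-Parity-0819-c3-0`, 2026-08-17. After part 2 (`…DimOneEquivalence.lean`) the crux
`DimOne` (Green–Tao Conj. 1.2 at `d = 1`: Dickson–Hardy–Littlewood with von Mangoldt weights, uniform in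
the shifts) is EXACTLY the registered stub `TwoFlatFactors` (correlations with at least two rough factors
`Λ♭_N = Λ − Λ_{ℤ/P_N}` are `o(N)`). This file proves the two families of instances of that stub (and of the
crux itself) that are theorems, so that the registered residual can be narrowed to the classical open core
(`t ≥ 2`, no local obstruction — the admissible prime `t`-tuple conjecture):

* `sum_twoFlat_eq_zero` — for `t ≤ 1` no term carries two rough factors (the `#T ≥ 2` sum is empty), whence
  `dimOne_one` — **the `t = 1` slice of the crux holds unconditionally** (one form `a n + b`, `|a| ≤ L`,
  `|b| ≤ LN`: the prime number theorem in progressions to moduli `≤ L`, uniformly in the shift, in Green–Tao's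
  normalisation; from the landed S♯ = `sharpMainTerm` and S1 = `oneFlatFactor`);
* `exists_dvd_eval_of_localFactor_eq_zero` — a LOCAL OBSTRUCTION `β_p(Ψ) = 0` means that every lattice
  point has a form divisible by `p`; `vonMangoldtSum_le_of_localFactor_eq_zero` — then
  `0 ≤ Σ_{K} ∏ Λ(ψ_i(n)) ≤ t · log₂(2LN) · log^t(2LN)`, because a contributing `n` has some `ψ_i(n)` a
  power `p^k ≤ 2LN` (`k ≥ 1`), each such value being taken at most once on `[−N, N]` (`d = 1`, `a_i ≠ 0`);
  with `𝔖(Ψ) = 0` (tree `singularProduct_eq_zero_of_localFactor_eq_zero`) this gives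
  `dimOne_of_localFactor_eq_zero` — **the crux holds for locally obstructed systems** (e.g. `(n, n + 1)`,
  `(n, n + 2, n + 4)`, any non-primitive form), uniformly — and, subtracting S♯ and S1,
  `twoFlatFactors_of_localFactor_eq_zero`;
* `abs_twoFlat_le`, `abs_sub_mainTerm_le` — the two triangle inequalities of the expansion
  `vonMangoldtSum = C_∅ + Σ_i C_{{i}} + Σ_{#T ≥ 2} C_T`, system by system;
* `twoFlatFactors_of_core'` — **`TwoFlatFactors` follows from its restriction to `t ≥ 2` and systems with
  `β_p(Ψ) > 0` at every prime** (`⟺ 𝔖(Ψ) > 0`, tree `singularProduct_pos_of_localFactor_pos`), stated with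
  the restriction unfolded (the named statement `TwoFlatFactorsCore` rides with the vocabulary file).

References: B. Green, T. Tao, *Linear equations in primes*, Ann. of Math. 171 (2010), Conj. 1.2, Lemma 1.3 and
the sentence following it ("could vanish, thanks to the presence of the small primes") [GreenTao2010];
L. E. Dickson, Messenger of Math. 33 (1904) [Dickson1904].
-/

noncomputable section

namespace Summit.Parity.GeneralizedHardyLittlewood.Cruxes.DimOne.BirthSieve

open scoped BigOperators Classical
open Finset Filter Literature.NumberTheory.Sieve
open Summit.Parity.GeneralizedHardyLittlewood.Theses.DicksonFibration (DimOne)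

variable {t : ℕ}

/-! ## The expansion, system by system -/

/-- `|Σ_{#T ≥ 2} C_T| ≤ |S − β_∞𝔖| + |C_∅ − β_∞𝔖| + |Σ_i C_{{i}}|` for one system, one body, one scale.
[folklore] -/
theorem abs_twoFlat_le (Ψ : Fin t → AffLinForm 1) (K : Set (Fin 1 → ℝ)) (N : ℕ) :
    |∑ T ∈ (univ : Finset (Fin t)).powerset.filter (fun T => 2 ≤ T.card), corrTerm T Ψ K N| ≤
      |vonMangoldtSum Ψ K N - archFactor Ψ K * singularProduct Ψ| +
        |corrTerm ∅ Ψ K N - archFactor Ψ K * singularProduct Ψ| + |∑ i : Fin t, corrTerm {i} Ψ K N| := by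
  have key : ∑ T ∈ (univ : Finset (Fin t)).powerset.filter (fun T => 2 ≤ T.card), corrTerm T Ψ K N =
      (vonMangoldtSum Ψ K N - archFactor Ψ K * singularProduct Ψ) -
        (corrTerm ∅ Ψ K N - archFactor Ψ K * singularProduct Ψ) - ∑ i : Fin t, corrTerm {i} Ψ K N := by
    rw [vonMangoldtSum_eq_sum_corrTerm, sum_powerset_split]
    ring
  rw [key]
  have h1 := abs_sub (vonMangoldtSum Ψ K N - archFactor Ψ K * singularProduct Ψ -
    (corrTerm ∅ Ψ K N - archFactor Ψ K * singularProduct Ψ)) (∑ i : Fin t, corrTerm {i} Ψ K N)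
  have h2 := abs_sub (vonMangoldtSum Ψ K N - archFactor Ψ K * singularProduct Ψ)
    (corrTerm ∅ Ψ K N - archFactor Ψ K * singularProduct Ψ)
  linarith

/-- `|S − β_∞𝔖| ≤ |C_∅ − β_∞𝔖| + |Σ_i C_{{i}}| + |Σ_{#T ≥ 2} C_T|` for one system, one body, one scale.
[folklore] -/
theorem abs_sub_mainTerm_le (Ψ : Fin t → AffLinForm 1) (K : Set (Fin 1 → ℝ)) (N : ℕ) :
    |vonMangoldtSum Ψ K N - archFactor Ψ K * singularProduct Ψ| ≤
      |corrTerm ∅ Ψ K N - archFactor Ψ K * singularProduct Ψ| + |∑ i : Fin t, corrTerm {i} Ψ K N| +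
        |∑ T ∈ (univ : Finset (Fin t)).powerset.filter (fun T => 2 ≤ T.card), corrTerm T Ψ K N| := by
  have key : vonMangoldtSum Ψ K N - archFactor Ψ K * singularProduct Ψ =
      (corrTerm ∅ Ψ K N - archFactor Ψ K * singularProduct Ψ) + ∑ i : Fin t, corrTerm {i} Ψ K N +
        ∑ T ∈ (univ : Finset (Fin t)).powerset.filter (fun T => 2 ≤ T.card), corrTerm T Ψ K N := by
    rw [vonMangoldtSum_eq_sum_corrTerm, sum_powerset_split]
    ring
  rw [key]
  exact abs_add_three _ _ _

/-- `|Σ_i C_{{i}}| ≤ t · η N` when every `|C_{{i}}| ≤ η N`. [folklore] -/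
theorem abs_sum_singleton_le (Ψ : Fin t → AffLinForm 1) (K : Set (Fin 1 → ℝ)) (N : ℕ) {η : ℝ}
    (h : ∀ i : Fin t, |corrTerm {i} Ψ K N| ≤ η * N) :
    |∑ i : Fin t, corrTerm {i} Ψ K N| ≤ t * (η * N) := by
  calc |∑ i : Fin t, corrTerm {i} Ψ K N| ≤ ∑ i : Fin t, |corrTerm {i} Ψ K N| :=
        Finset.abs_sum_le_sum_abs _ _
    _ ≤ ∑ _i : Fin t, η * N := Finset.sum_le_sum fun i _ => h i
    _ = t * (η * N) := by rw [Finset.sum_const, Finset.card_univ, Fintype.card_fin, nsmul_eq_mul]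

/-! ## `t ≤ 1`: no term has two rough factors -/

/-- For `t ≤ 1` there is no `T ⊆ [t]` with `#T ≥ 2`. [folklore] -/
theorem filter_two_le_card_eq_empty (ht : t ≤ 1) :
    (univ : Finset (Fin t)).powerset.filter (fun T => 2 ≤ T.card) = ∅ := by
  refine Finset.filter_eq_empty_iff.mpr fun T _ hT => ?_
  have h := Finset.card_le_univ T
  rw [Fintype.card_fin] at h
  omega

/-- **S2 is vacuous for `t ≤ 1`**: `Σ_{#T ≥ 2} C_T = 0`. [folklore] -/
theorem sum_twoFlat_eq_zero (ht : t ≤ 1) (Ψ : Fin t → AffLinForm 1) (K : Set (Fin 1 → ℝ)) (N : ℕ) :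
    ∑ T ∈ (univ : Finset (Fin t)).powerset.filter (fun T => 2 ≤ T.card), corrTerm T Ψ K N = 0 := by
  rw [filter_two_le_card_eq_empty ht, Finset.sum_empty]

/-- **The `t = 1` slice of the crux `DimOne` holds**: uniformly over non-degenerate single forms
`ψ(n) = a n + b` with `|a| + |b|/N ≤ L` and convex `K ⊆ [−N, N]`,
`|Σ_{n ∈ K} Λ(a n + b) − β_∞ · 𝟙_{(a,b)=1} |a|/φ(|a|)| ≤ ε N` for `N ≥ N₀(L, ε)` — the prime number theorem
in progressions to bounded moduli, uniform in the shift, in Green–Tao's normalisation (S♯ + S1; S2 is empty).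
[cite: GreenTao2010, Conj. 1.2] -/
theorem dimOne_one : ∀ L : ℕ, ∀ ε : ℝ, 0 < ε → ∃ N₀ : ℕ, ∀ N : ℕ, N₀ ≤ N →
    ∀ Ψ : Fin 1 → AffLinForm 1, IsNondegenerateSystem Ψ → affLinSize Ψ N ≤ L →
      ∀ K : Set (Fin 1 → ℝ), Convex ℝ K → K ⊆ realBox 1 N →
        |vonMangoldtSum Ψ K N - archFactor Ψ K * singularProduct Ψ| ≤ ε * (N : ℝ) := by
  intro L ε hε
  obtain ⟨N₁, hN₁⟩ := sharpMainTerm 1 L le_rfl (ε / 2) (by positivity)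
  obtain ⟨N₂, hN₂⟩ := oneFlatFactor 1 L le_rfl (ε / 2) (by positivity)
  refine ⟨max N₁ N₂, fun N hN Ψ hΨ hL K hK hKN => ?_⟩
  have h1 := hN₁ N (le_of_max_le_left hN) Ψ hΨ hL K hK hKN
  have h2 := abs_sum_singleton_le Ψ K N (hN₂ N (le_of_max_le_right hN) Ψ hΨ hL K hK hKN)
  have h3 := abs_sub_mainTerm_le Ψ K N
  rw [sum_twoFlat_eq_zero le_rfl, abs_zero, add_zero] at h3
  calc |vonMangoldtSum Ψ K N - archFactor Ψ K * singularProduct Ψ|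
      ≤ ε / 2 * N + 1 * (ε / 2 * N) := h3.trans (add_le_add h1 (by exact_mod_cast h2))
    _ = ε * N := by ring

/-! ## Locally obstructed systems -/

/-- **A local obstruction is an obstruction at every lattice point**: if `β_p(Ψ) = 0` at a prime `p`, then
for every `n ∈ ℤ^d` some form `ψ_i(n)` is divisible by `p` (`β_p = p^{-d}(p/(p−1))^t g_p` with `g_p` the
number of good residues, tree `localFactor_prime`). [cite: GreenTao2010, (1.6) and Lemma 1.3] -/
theorem exists_dvd_eval_of_localFactor_eq_zero {d : ℕ} (Ψ : Fin t → AffLinForm d) {p : ℕ}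
    (hp : p.Prime) (h0 : localFactor Ψ p = 0) (n : Fin d → ℤ) : ∃ i, (p : ℤ) ∣ (Ψ i).eval n := by
  haveI := Fact.mk hp
  have hp2 : (2 : ℝ) ≤ p := by exact_mod_cast hp.two_le
  have hg : goodCount Ψ p = 0 := by
    rw [localFactor_prime] at h0
    have h1 : ((p : ℝ) ^ d)⁻¹ ≠ 0 := inv_ne_zero (pow_ne_zero _ (by linarith))
    have h2 : ((p : ℝ) / (p - 1)) ^ t ≠ 0 := pow_ne_zero _ (div_ne_zero (by linarith) (by linarith))
    rcases mul_eq_zero.mp h0 with h | h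
    · exact absurd h h1
    · rcases mul_eq_zero.mp h with h' | h'
      · exact absurd h' h2
      · exact_mod_cast h'
  have hv : ¬ ∀ i, ¬ (Ψ i).modEval p (fun j => (n j : ZMod p)) = 0 := by
    intro hall
    have hmem : (fun j => (n j : ZMod p)) ∈
        (Finset.univ.filter fun v : Fin d → ZMod p => ∀ i, ¬ (Ψ i).modEval p v = 0) :=
      Finset.mem_filter.mpr ⟨Finset.mem_univ _, hall⟩
    unfold goodCount at hg
    rw [Finset.card_eq_zero.mp hg] at hmem
    exact Finset.notMem_empty _ hmem
  push Not at hv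
  obtain ⟨i, hi⟩ := hv
  refine ⟨i, ?_⟩
  rw [← ZMod.intCast_zmod_eq_zero_iff_dvd, AffLinForm.intCast_eval]
  exact hi

/-- On `[−N, N]`, a form of a non-degenerate `d = 1` system takes each value at most once (`a_i ≠ 0`).
[folklore] -/
theorem card_filter_eval_eq_le_one {Ψ : Fin t → AffLinForm 1} (hΨ : IsNondegenerateSystem Ψ)
    (i : Fin t) (N : ℕ) (v : ℤ) : #{n ∈ latticeBox 1 N | (Ψ i).eval n = v} ≤ 1 := by
  obtain ⟨j, hj⟩ := exists_coeff_ne_zero hΨ i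
  simpa using card_filter_eval_eq_le (Ψ i) hj N v

/-- **Locally obstructed systems have negligible prime-tuple sums.** If `β_p(Ψ) = 0` at a prime `p`, then for
`‖Ψ‖_N ≤ L` (`L, N ≥ 1`) and any `K`:
`0 ≤ Σ_{n ∈ K ∩ [−N,N]} ∏_i Λ(ψ_i(n)) ≤ t · log₂⌊2LN⌋ · log^t(2LN)`.
Indeed a contributing `n` has every `ψ_i(n)` a prime power and some `ψ_i(n) ≡ 0 (p)`, so that `ψ_i(n) = p^k`
with `1 ≤ k`, `p^k ≤ 2LN`; each such value is taken at most once, and each term is `≤ log^t(2LN)`.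
[cite: GreenTao2010, sentence following Lemma 1.3] -/
theorem vonMangoldtSum_le_of_localFactor_eq_zero {Ψ : Fin t → AffLinForm 1}
    (hΨ : IsNondegenerateSystem Ψ) {N : ℕ} (hN : 1 ≤ N) {L : ℝ} (hL1 : 1 ≤ L) (hL : affLinSize Ψ N ≤ L)
    {p : ℕ} (hp : p.Prime) (h0 : localFactor Ψ p = 0) (K : Set (Fin 1 → ℝ)) :
    0 ≤ vonMangoldtSum Ψ K N ∧
      vonMangoldtSum Ψ K N ≤ t * Nat.log 2 ⌊2 * L * N⌋₊ * Real.log (2 * L * N) ^ t := by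
  set M : ℕ := ⌊2 * L * N⌋₊ with hM
  -- the exceptional lattice points: some form is a power `p^k`, `1 ≤ k ≤ log₂ M`
  set Bad : Finset (Fin 1 → ℤ) := (Finset.univ : Finset (Fin t)).biUnion (fun i =>
    (Finset.Icc 1 (Nat.log 2 M)).biUnion (fun k =>
      (latticeBox 1 N).filter (fun n => (Ψ i).eval n = (p : ℤ) ^ k))) with hBad
  have hBadsub : Bad ⊆ latticeBox 1 N :=
    Finset.biUnion_subset.mpr fun i _ => Finset.biUnion_subset.mpr fun k _ => Finset.filter_subset _ _
  have hf0 : ∀ n : Fin 1 → ℤ, 0 ≤ ∏ i, intVonMangoldt ((Ψ i).eval n) := fun n =>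
    Finset.prod_nonneg fun i _ => intVonMangoldt_nonneg _
  refine ⟨Finset.sum_nonneg fun n _ => hf0 n, ?_⟩
  -- a non-zero summand lies in `Bad`
  have hsupp : ∀ n ∈ latticeBox 1 N, ∏ i, intVonMangoldt ((Ψ i).eval n) ≠ 0 → n ∈ Bad := by
    intro n hn hne
    obtain ⟨i, hdvd⟩ := exists_dvd_eval_of_localFactor_eq_zero Ψ hp h0 n
    have hΛ : intVonMangoldt ((Ψ i).eval n) ≠ 0 := fun h =>
      hne (Finset.prod_eq_zero (Finset.mem_univ i) h)
    unfold intVonMangoldt at hΛ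
    obtain ⟨q, k, hq, hk, hqk⟩ :=
      (isPrimePow_nat_iff _).mp (ArithmeticFunction.vonMangoldt_ne_zero_iff.mp hΛ)
    have hpos : 0 < (Ψ i).eval n := by
      by_contra hle
      push Not at hle
      rw [Int.toNat_eq_zero.mpr hle] at hqk
      exact pow_ne_zero k hq.ne_zero hqk
    have hval : (Ψ i).eval n = ((q ^ k : ℕ) : ℤ) := by
      rw [hqk]
      exact (Int.toNat_of_nonneg hpos.le).symm
    have hpq : p = q := by
      have h1 : (p : ℤ) ∣ ((q ^ k : ℕ) : ℤ) := hval ▸ hdvd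
      have h2 : p ∣ q ^ k := by exact_mod_cast h1
      exact (Nat.prime_dvd_prime_iff_eq hp hq).mp (hp.dvd_of_dvd_pow h2)
    subst hpq
    have hle : p ^ k ≤ M := by
      have habs := abs_eval_le_of_affLinSize_le hN hL hn i
      have h3 : (((p ^ k : ℕ) : ℤ) : ℝ) ≤ 2 * L * N := by
        rw [← hval]
        exact (le_abs_self _).trans habs
      have h4 : ((p ^ k : ℕ) : ℝ) ≤ 2 * L * N := by exact_mod_cast h3
      exact Nat.le_floor h4
    have hkM : k ≤ Nat.log 2 M :=
      (Nat.le_log_of_pow_le hp.one_lt hle).trans (Nat.log_anti_left (by norm_num) hp.two_le)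
    rw [hBad, Finset.mem_biUnion]
    refine ⟨i, Finset.mem_univ i, Finset.mem_biUnion.mpr ⟨k, Finset.mem_Icc.mpr ⟨hk, hkM⟩, ?_⟩⟩
    refine Finset.mem_filter.mpr ⟨hn, ?_⟩
    rw [hval]
    push_cast
    rfl
  -- `#Bad ≤ t · log₂ M`
  have hcard : (#Bad : ℝ) ≤ t * Nat.log 2 M := by
    have h2 : #Bad ≤ t * Nat.log 2 M := by
      refine Finset.card_biUnion_le.trans ?_
      calc ∑ i : Fin t, #((Finset.Icc 1 (Nat.log 2 M)).biUnion (fun k =>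
              (latticeBox 1 N).filter (fun n => (Ψ i).eval n = (p : ℤ) ^ k)))
          ≤ ∑ _i : Fin t, Nat.log 2 M := Finset.sum_le_sum fun i _ => ?_
        _ = t * Nat.log 2 M := by
            rw [Finset.sum_const, Finset.card_univ, Fintype.card_fin, smul_eq_mul]
      refine Finset.card_biUnion_le.trans ?_
      calc ∑ k ∈ Finset.Icc 1 (Nat.log 2 M), #((latticeBox 1 N).filter (fun n => (Ψ i).eval n = (p : ℤ) ^ k))
          ≤ ∑ _k ∈ Finset.Icc 1 (Nat.log 2 M), 1 :=
            Finset.sum_le_sum fun k _ => card_filter_eval_eq_le_one hΨ i N _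
        _ = Nat.log 2 M := by
            rw [Finset.sum_const, smul_eq_mul, mul_one, Nat.card_Icc]
            omega
    exact_mod_cast h2
  have hlog : ∀ n ∈ latticeBox 1 N, ∏ i, intVonMangoldt ((Ψ i).eval n) ≤ Real.log (2 * L * N) ^ t :=
    fun n hn => (prod_intVonMangoldt_le hN hL1 hL hn).2
  have hlog0 : 0 ≤ Real.log (2 * L * N) ^ t := by
    refine pow_nonneg (Real.log_nonneg ?_) _
    have : (1 : ℝ) ≤ N := by exact_mod_cast hN
    nlinarith
  calc vonMangoldtSum Ψ K N
      ≤ ∑ n ∈ latticeBox 1 N, ∏ i, intVonMangoldt ((Ψ i).eval n) := by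
        unfold vonMangoldtSum
        exact Finset.sum_le_sum_of_subset_of_nonneg (Finset.filter_subset _ _) (fun n _ _ => hf0 n)
    _ = ∑ n ∈ Bad, ∏ i, intVonMangoldt ((Ψ i).eval n) := by
        symm
        refine Finset.sum_subset hBadsub (fun n hn hnB => ?_)
        by_contra hne
        exact hnB (hsupp n hn hne)
    _ ≤ ∑ _n ∈ Bad, Real.log (2 * L * N) ^ t :=
        Finset.sum_le_sum fun n hn => hlog n (hBadsub hn)
    _ = #Bad * Real.log (2 * L * N) ^ t := by rw [Finset.sum_const, nsmul_eq_mul]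
    _ ≤ t * Nat.log 2 M * Real.log (2 * L * N) ^ t := mul_le_mul_of_nonneg_right hcard hlog0

/-- **The crux `DimOne` holds for locally obstructed systems**: uniformly over non-degenerate `Ψ` of `t` forms
with `‖Ψ‖_N ≤ L` having `β_p(Ψ) = 0` at some prime `p`, and over all `K`,
`|Σ_K ∏Λ(ψ_i n) − β_∞ 𝔖(Ψ)| ≤ ε N` for `N ≥ N₀(t, L, ε)` (`𝔖(Ψ) = 0` and the sum is `O_{t,L}(log^{t+1} N)`).
[cite: GreenTao2010, Conj. 1.2 and the sentence following Lemma 1.3] -/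
theorem dimOne_of_localFactor_eq_zero : ∀ (t L : ℕ), ∀ ε : ℝ, 0 < ε → ∃ N₀ : ℕ, ∀ N : ℕ, N₀ ≤ N →
    ∀ Ψ : Fin t → AffLinForm 1, IsNondegenerateSystem Ψ → affLinSize Ψ N ≤ L →
      ∀ p : ℕ, p.Prime → localFactor Ψ p = 0 →
        ∀ K : Set (Fin 1 → ℝ), |vonMangoldtSum Ψ K N - archFactor Ψ K * singularProduct Ψ| ≤ ε * (N : ℝ) := by
  intro t L ε hε
  set L' : ℝ := (L : ℝ) + 1 with hL'
  have hL0 : (0 : ℝ) ≤ L := Nat.cast_nonneg L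
  have hL'1 : 1 ≤ L' := by rw [hL']; linarith
  set c : ℝ := 2 * t * (2 * L') / ε with hc
  obtain ⟨x₀, hx₀⟩ := Filter.eventually_atTop.mp (eventually_const_mul_log_pow_le c (t + 1))
  refine ⟨max 1 ⌈x₀⌉₊, fun N hN Ψ hΨ hL p hp h0 K => ?_⟩
  have hN1 : 1 ≤ N := le_of_max_le_left hN
  have hN1r : (1 : ℝ) ≤ N := by exact_mod_cast hN1
  have hNx : x₀ ≤ (N : ℝ) := (Nat.le_ceil x₀).trans (by exact_mod_cast le_of_max_le_right hN)
  have hx : x₀ ≤ 2 * L' * N := hNx.trans (by nlinarith)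
  have hLL' : affLinSize Ψ N ≤ L' := hL.trans (by rw [hL']; linarith)
  have hS := vonMangoldtSum_le_of_localFactor_eq_zero hΨ hN1 hL'1 hLL' hp h0 K
  rw [singularProduct_eq_zero_of_localFactor_eq_zero Ψ hΨ hp h0, mul_zero, sub_zero, abs_of_nonneg hS.1]
  set M : ℕ := ⌊2 * L' * N⌋₊ with hM
  have h2LN : (1 : ℝ) ≤ 2 * L' * N := by nlinarith
  have hM1 : 1 ≤ M := Nat.le_floor (by exact_mod_cast h2LN)
  have hMle : (M : ℝ) ≤ 2 * L' * N := Nat.floor_le (by linarith)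
  have hlogM : Real.log M ≤ Real.log (2 * L' * N) :=
    Real.log_le_log (by exact_mod_cast (show (0 : ℕ) < M by omega)) hMle
  -- `log₂ M ≤ log M / log 2 ≤ 2 log M` (tree: `Literature.Computability.Complexity.natLog_two_le_two_mul_log`)
  have hnatlog : (Nat.log 2 M : ℝ) ≤ 2 * Real.log M := by
    have h := Real.natLog_le_logb M 2
    have hlog2 : (1 : ℝ) / 2 < Real.log 2 := by
      have := Real.log_two_gt_d9
      linarith
    have hM0 : 0 ≤ Real.log M := Real.log_nonneg (by exact_mod_cast hM1)
    calc (Nat.log 2 M : ℝ) ≤ Real.logb 2 M := h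
      _ = Real.log M / Real.log 2 := rfl
      _ ≤ Real.log M / (1 / 2) := div_le_div_of_nonneg_left hM0 (by norm_num) hlog2.le
      _ = 2 * Real.log M := by ring
  have hX0 : 0 ≤ Real.log (2 * L' * N) := Real.log_nonneg h2LN
  have hXt0 : 0 ≤ Real.log (2 * L' * N) ^ t := pow_nonneg hX0 _
  have ht0 : (0 : ℝ) ≤ t := Nat.cast_nonneg t
  have key := hx₀ (2 * L' * N) hx
  -- `2t log^{t+1}(2L'N) ≤ εN`
  have hmain : 2 * t * Real.log (2 * L' * N) ^ (t + 1) ≤ ε * N := by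
    have h1 : 2 * t * Real.log (2 * L' * N) ^ (t + 1) = ε / (2 * L') * (c * Real.log (2 * L' * N) ^ (t + 1)) := by
      rw [hc]
      field_simp
    rw [h1]
    calc ε / (2 * L') * (c * Real.log (2 * L' * N) ^ (t + 1))
        ≤ ε / (2 * L') * (2 * L' * N) := mul_le_mul_of_nonneg_left key (by positivity)
      _ = ε * N := by field_simp
  calc vonMangoldtSum Ψ K N ≤ t * Nat.log 2 M * Real.log (2 * L' * N) ^ t := hS.2
    _ ≤ t * (2 * Real.log (2 * L' * N)) * Real.log (2 * L' * N) ^ t := by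
        refine mul_le_mul_of_nonneg_right (mul_le_mul_of_nonneg_left ?_ ht0) hXt0
        exact hnatlog.trans (by linarith)
    _ = 2 * t * Real.log (2 * L' * N) ^ (t + 1) := by ring
    _ ≤ ε * N := hmain

/-- **S2 holds for locally obstructed systems** (flat form of the previous theorem, subtracting the landed S♯ and
S1): uniformly over non-degenerate `Ψ` with `‖Ψ‖_N ≤ L` and `β_p(Ψ) = 0` at some prime, and convex `K ⊆ [−N, N]`,
`|Σ_{#T ≥ 2} C_T| ≤ ε N` for `N ≥ N₀(t, L, ε)`. [cite: GreenTao2010, Conj. 1.2 and §12 (12.3)] -/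
theorem twoFlatFactors_of_localFactor_eq_zero : ∀ (t L : ℕ), ∀ ε : ℝ, 0 < ε → ∃ N₀ : ℕ, ∀ N : ℕ, N₀ ≤ N →
    ∀ Ψ : Fin t → AffLinForm 1, IsNondegenerateSystem Ψ → affLinSize Ψ N ≤ L →
      ∀ p : ℕ, p.Prime → localFactor Ψ p = 0 →
        ∀ K : Set (Fin 1 → ℝ), Convex ℝ K → K ⊆ realBox 1 N →
          |∑ T ∈ (univ : Finset (Fin t)).powerset.filter (fun T => 2 ≤ T.card), corrTerm T Ψ K N|
            ≤ ε * (N : ℝ) := by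
  intro t L ε hε
  rcases Nat.lt_or_ge t 1 with ht | ht
  · refine ⟨0, fun N _ Ψ _ _ p _ _ K _ _ => ?_⟩
    rw [sum_twoFlat_eq_zero (by omega), abs_zero]
    positivity
  · have htpos : (0 : ℝ) < t := by exact_mod_cast ht
    obtain ⟨N₁, hN₁⟩ := dimOne_of_localFactor_eq_zero t L (ε / 3) (by positivity)
    obtain ⟨N₂, hN₂⟩ := sharpMainTerm t L ht (ε / 3) (by positivity)
    obtain ⟨N₃, hN₃⟩ := oneFlatFactor t L ht (ε / (3 * t)) (by positivity)
    refine ⟨max N₁ (max N₂ N₃), fun N hN Ψ hΨ hL p hp h0 K hK hKN => ?_⟩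
    have h1 := hN₁ N (le_of_max_le_left hN) Ψ hΨ hL p hp h0 K
    have h2 := hN₂ N (le_of_max_le_left (le_of_max_le_right hN)) Ψ hΨ hL K hK hKN
    have h3 := abs_sum_singleton_le Ψ K N
      (hN₃ N (le_of_max_le_right (le_of_max_le_right hN)) Ψ hΨ hL K hK hKN)
    calc _ ≤ _ := abs_twoFlat_le Ψ K N
      _ ≤ ε / 3 * N + ε / 3 * N + t * (ε / (3 * t) * N) := add_le_add_three h1 h2 h3
      _ = ε * N := by field_simp; ring

/-! ## The open core: `t ≥ 2`, no local obstruction -/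

/-- **`TwoFlatFactors` from its open core.** If S2 holds for `t ≥ 2` forms and systems with `β_p(Ψ) > 0` at
every prime (no local obstruction; `⟺ 𝔖(Ψ) > 0`), then it holds outright: `t ≤ 1` is `sum_twoFlat_eq_zero`
and an obstructed prime is `twoFlatFactors_of_localFactor_eq_zero` (`β_p ≥ 0` always). The hypothesis is the
registered stub `stub_twoFlatFactorsCore` of the skeleton, unfolded. [cite: GreenTao2010, Conj. 1.2] -/
theorem twoFlatFactors_of_core' :
    (∀ (t L : ℕ), 2 ≤ t → ∀ ε : ℝ, 0 < ε → ∃ N₀ : ℕ, ∀ N : ℕ, N₀ ≤ N →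
      ∀ Ψ : Fin t → AffLinForm 1, IsNondegenerateSystem Ψ → affLinSize Ψ N ≤ L →
        (∀ p : ℕ, p.Prime → 0 < localFactor Ψ p) →
          ∀ K : Set (Fin 1 → ℝ), Convex ℝ K → K ⊆ realBox 1 N →
            |∑ T ∈ (univ : Finset (Fin t)).powerset.filter (fun T => 2 ≤ T.card), corrTerm T Ψ K N|
              ≤ ε * (N : ℝ)) →
    TwoFlatFactors := by
  intro hcore t L _ht ε hε
  obtain ⟨N₁, hN₁⟩ := twoFlatFactors_of_localFactor_eq_zero t L ε hε
  rcases Nat.lt_or_ge t 2 with ht2 | ht2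
  · refine ⟨0, fun N _ Ψ _ _ K _ _ => ?_⟩
    rw [sum_twoFlat_eq_zero (by omega), abs_zero]
    positivity
  · obtain ⟨N₂, hN₂⟩ := hcore t L ht2 ε hε
    refine ⟨max N₁ N₂, fun N hN Ψ hΨ hL K hK hKN => ?_⟩
    by_cases hob : ∃ p : ℕ, p.Prime ∧ localFactor Ψ p = 0
    · obtain ⟨p, hp, h0⟩ := hob
      exact hN₁ N (le_of_max_le_left hN) Ψ hΨ hL p hp h0 K hK hKN
    · push Not at hob
      have hpos : ∀ p : ℕ, p.Prime → 0 < localFactor Ψ p := fun p hp =>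
        lt_of_le_of_ne (localFactor_nonneg Ψ p) (fun h => hob p hp h.symm)
      exact hN₂ N (le_of_max_le_right hN) Ψ hΨ hL hpos K hK hKN

end Summit.Parity.GeneralizedHardyLittlewood.Cruxes.DimOne.BirthSieve

end
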